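import Literature.NumberTheory.Automorphic.ShimuraCurveRibetTakahashi
import HarnessLib

/-!
# Pasten's refined Ribet–Takahashi formula (Thm 6.1): the printed forms, proved from the facts

Topic `NumberTheory/Automorphic`; a proofs-only companion (theorems only) of
`ShimuraCurveRibetTakahashi.lean` for its named facts `PastenShimura2024_thm_6_1` and
`PastenShimura2024_thm_6_1_b` (the sibling `ShimuraCurveRibetTakahashiProofs.lean` serves
`PastenShimura2024_cor_10_2`). The two facts render Pasten's
Theorem 6.1 (J. Number Theory 254 (2024) = arXiv:1705.09251, p. 20) in cleared-denominator form,
`δ_{1,N} · b = a · δ_{D,M} · ∏_{p∣D} v_p(Δ_E)` with side conditions on the positive integers `a, b`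
(`a ≤ 163^{ω(D)}` supported on primes `≤ 163`, resp. `b ∣ κ^{ω(D)}`). This file PROVES, from those
named facts and elementary arithmetic only, the forms actually printed on p. 20:

* `PastenShimura2024_thm_6_1_b.den_dvd` — part (b) as printed: "the denominator of `γ_{D,M,E}`
  divides `κ^{ω(D)}`", for the rational number
  `γ_{D,M,E} = δ_{1,N} / (δ_{D,M} · ∏_{p∣D} v_p(Δ_E))` of display (6.1) (Mathlib `Rat.den`),
  together with `∏_{p∣D} v_p(Δ_E) ≠ 0` (forced by `δ_{1,N} b ≠ 0`).
* `PastenShimura2024_thm_6_1_b_of_den_dvd`, `PastenShimura2024_thm_6_1_b_iff_den_dvd` — the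
  converse, so that the tree's cleared-denominator rendering is EQUIVALENT to the printed
  statement (`a = num γ`, `b = den γ`).
* `PastenShimura2024_thm_6_1_b.log_prod_le` — the "In particular" of part (b):
  "`log(∏_{p∣D} v_p(Δ_E)) ≤ log δ_{1,N} − log δ_{D,M} + O(ω(D))` where the implicit constant is
  absolute", here with the explicit absolute constant `log κ ≥ 0`.
* `PastenShimura2024_thm_6_1.log_le` — the "In particular" of the numerator statement,
  (EqUpperRT): "`log δ_{1,N} ≤ log δ_{D,M} + log(∏_{p∣D} v_p(Δ_E)) + 5.1 · ω(D)`"; the numerical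
  input `log 163 ≤ 5.1` (`163 < e^{5.1}`) is `log_163_le` below, from Mathlib's
  `Real.exp_one_gt_d9` and `x + 1 ≤ eˣ`.

Conventions as in the facts file: `E` is a globally minimal `W`, `δ_{1,N} = D₁.modularDegree`
(class-minimal classical datum carrying the newform of `W`), `δ_{D,M} = P.deg` (`P.IsMinimalFor W`),
`v_p(Δ_E) = (W.minimalDiscriminantNorm ℤ).factorization p`, `ω(D) = #D.primeFactors`.

No definitions and no named facts are introduced; the discharges `…_holds` of the two facts are NOT
in this file (Pasten's proof, §6.3–6.9 pp. 21–25, rests on Néron models and component groups of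
`J₀^D(M)`, Ribet–Takahashi's Theorem 2 = Prop. 6.13, the Eisenstein property of `Φ_p` (Lemma 6.14),
Thm. 6.17 (level-lowering, Wiles, Darmon–Merel, Darmon–Granville) and Mazur–Kenku (Lemma 6.8),
none of which exists in Mathlib or the tree).

## References

* [PastenShimura2024] H. Pasten, *Shimura curves and the abc conjecture*, J. Number Theory 254
  (2024) 214–335 = arXiv:1705.09251: Thm. 6.1 p. 20 (display (6.1), (EqUpperRT), part (b) and its
  "In particular").
-/

noncomputable section

open scoped MatrixGroups ModularForm

namespace Literature.NumberTheory.Automorphic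

open Literature.NumberTheory.EllipticCurves.ModularForms (ModularParametrizationData IsNewformOf)

/-! ### Arithmetic core: the cleared-denominator identity `δ₁ · b = a · δ · Pv` -/

/-- From `δ₁ · b = a · δ · Pv` with `δ₁, b > 0`: `Pv ≠ 0`. [folklore] -/
theorem prod_ne_zero_of_clearedDenominators {δ₁ b a δ Pv : ℕ} (hδ₁ : 0 < δ₁) (hb : 0 < b)
    (h : δ₁ * b = a * δ * Pv) : Pv ≠ 0 := by
  rintro rfl
  rw [mul_zero] at h
  exact (Nat.mul_pos hδ₁ hb).ne' h

/-- From `δ₁ · b = a · δ · Pv` with `b, δ, Pv ≠ 0`: `δ₁ / (δ Pv) = a / b` in `ℚ`. [folklore] -/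
theorem div_eq_div_of_clearedDenominators {δ₁ b a δ Pv : ℕ} (hb : b ≠ 0) (hδ : δ ≠ 0)
    (hPv : Pv ≠ 0) (h : δ₁ * b = a * δ * Pv) :
    (δ₁ : ℚ) / ((δ : ℚ) * Pv) = (a : ℚ) / b := by
  rw [div_eq_div_iff (by positivity) (by exact_mod_cast hb)]
  exact_mod_cast h.trans (mul_assoc a δ Pv)

/-- From `δ₁ · b = a · δ · Pv` with `b, δ, Pv ≠ 0`: the denominator of the rational number
`δ₁ / (δ Pv)` divides `b` (it equals `a / b`, and `den (a/b) ∣ b`, Mathlib `Rat.den_dvd`). [folklore] -/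
theorem den_div_dvd_of_clearedDenominators {δ₁ b a δ Pv : ℕ} (hb : b ≠ 0) (hδ : δ ≠ 0)
    (hPv : Pv ≠ 0) (h : δ₁ * b = a * δ * Pv) :
    ((δ₁ : ℚ) / ((δ : ℚ) * Pv)).den ∣ b := by
  rw [div_eq_div_of_clearedDenominators hb hδ hPv h]
  have hden := Rat.den_dvd (a : ℤ) (b : ℤ)
  rw [Rat.divInt_eq_div, Int.cast_natCast, Int.cast_natCast] at hden
  exact_mod_cast hden

/-- From `δ₁ · b = a · δ · Pv` with `a ≥ 1`, `b ≤ K` (all positive): the printed logarithmic form of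
part (b), `log Pv ≤ log δ₁ − log δ + log K`. [folklore] -/
theorem log_prod_le_of_clearedDenominators {δ₁ b a δ Pv K : ℕ} (hδ₁ : 0 < δ₁) (ha : 0 < a)
    (hb : 0 < b) (hδ : 0 < δ) (hbK : b ≤ K) (h : δ₁ * b = a * δ * Pv) :
    Real.log Pv ≤ Real.log δ₁ - Real.log δ + Real.log K := by
  have hPv : 0 < Pv := Nat.pos_of_ne_zero (prod_ne_zero_of_clearedDenominators hδ₁ hb h)
  have hK : 0 < K := lt_of_lt_of_le hb hbK
  -- `δ Pv ≤ a δ Pv = δ₁ b ≤ δ₁ K`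
  have hle : (δ : ℝ) * Pv ≤ δ₁ * K := by
    have h1 : δ * Pv ≤ a * δ * Pv := by
      calc δ * Pv = 1 * δ * Pv := by rw [one_mul]
        _ ≤ a * δ * Pv := Nat.mul_le_mul_right _ (Nat.mul_le_mul_right _ ha)
    have h2 : δ * Pv ≤ δ₁ * K := (h1.trans_eq h.symm).trans (Nat.mul_le_mul_left _ hbK)
    exact_mod_cast h2
  have hlog := Real.log_le_log (by positivity) hle
  rw [Real.log_mul (by positivity) (by positivity), Real.log_mul (by positivity) (by positivity)]
    at hlog
  linarith

/-- From `δ₁ · b = a · δ · Pv` with `b ≥ 1`, `a ≤ A` (all positive): the logarithmic form of the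
numerator statement, `log δ₁ ≤ log δ + log Pv + log A`. [folklore] -/
theorem log_le_of_clearedDenominators {δ₁ b a δ Pv A : ℕ} (hδ₁ : 0 < δ₁) (ha : 0 < a)
    (hb : 0 < b) (hδ : 0 < δ) (haA : a ≤ A) (h : δ₁ * b = a * δ * Pv) :
    Real.log δ₁ ≤ Real.log δ + Real.log Pv + Real.log A := by
  have hPv : 0 < Pv := Nat.pos_of_ne_zero (prod_ne_zero_of_clearedDenominators hδ₁ hb h)
  have hA : 0 < A := lt_of_lt_of_le ha haA
  -- `δ₁ ≤ δ₁ b = a δ Pv ≤ A δ Pv`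
  have hle : (δ₁ : ℝ) ≤ A * (δ * Pv) := by
    have h1 : δ₁ ≤ δ₁ * b := Nat.le_mul_of_pos_right _ hb
    have h2 : δ₁ ≤ A * (δ * Pv) := by
      calc δ₁ ≤ δ₁ * b := h1
        _ = a * δ * Pv := h
        _ ≤ A * δ * Pv := Nat.mul_le_mul_right _ (Nat.mul_le_mul_right _ haA)
        _ = A * (δ * Pv) := mul_assoc A δ Pv
    exact_mod_cast h2
  have hlog := Real.log_le_log (by positivity) hle
  rw [Real.log_mul (by positivity) (by positivity), Real.log_mul (by positivity) (by positivity)]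
    at hlog
  linarith

/-- **`log 163 ≤ 5.1`** (Pasten p. 20, the constant of (EqUpperRT): `5.1 · ω(D)` for
`ω(D) · log 163`): `163 < e^{5.1}` because `e^{5.1} = (e^1)^5 · e^{0.1} ≥ 2.7182818283^5 · 1.1 > 163`.
[cite: PastenShimura2024, Thm. 6.1 p. 20 ((EqUpperRT), constant 5.1)] -/
theorem log_163_le : Real.log 163 ≤ 5.1 := by
  rw [Real.log_le_iff_le_exp (by norm_num)]
  have h1 : (2.7182818283 : ℝ) < Real.exp 1 := Real.exp_one_gt_d9
  have h5 : (2.7182818283 : ℝ) ^ 5 ≤ Real.exp 5 := by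
    have : Real.exp 5 = Real.exp 1 ^ 5 := by rw [← Real.exp_nat_mul]; norm_num
    rw [this]
    exact pow_le_pow_left₀ (by norm_num) h1.le 5
  have h01 : (0.1 : ℝ) + 1 ≤ Real.exp 0.1 := Real.add_one_le_exp _
  have hsplit : Real.exp 5.1 = Real.exp 5 * Real.exp 0.1 := by
    rw [← Real.exp_add]; norm_num
  rw [hsplit]
  calc (163 : ℝ) ≤ (2.7182818283 : ℝ) ^ 5 * (0.1 + 1) := by norm_num
    _ ≤ Real.exp 5 * Real.exp 0.1 :=
        mul_le_mul h5 h01 (by norm_num) (Real.exp_pos _).le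

/-! ### Theorem 6.1 (b): the printed denominator statement and its logarithmic form -/

/-- **Pasten 2024, Thm. 6.1 (b), as printed: "the denominator of `γ_{D,M,E}` divides `κ^{ω(D)}`"**
— PROVED from the named fact `PastenShimura2024_thm_6_1_b` (cleared-denominator rendering). Here
`γ_{D,M,E} = δ_{1,N} / (δ_{D,M} · ∏_{p∣D} v_p(Δ_E))` is the positive rational number of display (6.1)
p. 20 (`δ_{1,N}/δ_{D,M} = γ_{D,M,E} · ∏_{p∣D} v_p(Δ_E)`), written with Mathlib's `Rat.den`
("the numerator and denominator of `x` are the unique coprime positive integers `a, b` with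
`x = a/b`", p. 20); the conjunct `∏_{p∣D} v_p(Δ_E) ≠ 0` records that `γ_{D,M,E}` is a genuine
quotient. Same `κ` (absolute, `≥ 1`, supported on primes `≤ 163`), same hypotheses (b.1)/(b.2)
and same rendering of `δ_{1,N}`, `δ_{D,M}` as the fact. [cite: PastenShimura2024, Thm. 6.1 (b) p. 20 and display (6.1)] -/
theorem PastenShimura2024_thm_6_1_b.den_dvd (h : PastenShimura2024_thm_6_1_b) :
    ∃ κ : ℕ, 1 ≤ κ ∧ (∀ p ∈ κ.primeFactors, p ≤ 163) ∧
    ∀ {N D M : ℕ} [NeZero N], IsAdmissibleFactorization N D M →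
      ∀ (X : ShimuraCurveData D M) (W : WeierstrassCurve ℚ) [W.IsElliptic] [W.IsGloballyMinimal],
        W.conductorNorm ℤ = N →
        (W.IsSemistable ℤ ∧ ¬ M.Prime) ∨
          (IsFreyHellegouarch W ∧ 2 ≤ (M.primeFactors.erase 2).card) →
      ∀ (W₁ : WeierstrassCurve ℚ) [W₁.IsElliptic] (D₁ : ModularParametrizationData W₁ N),
        IsNewformOf W D₁.f →
        (∀ (W₂ : WeierstrassCurve ℚ) [W₂.IsElliptic] (D₂ : ModularParametrizationData W₂ N),
            D₂.f = D₁.f → D₁.modularDegree ≤ D₂.modularDegree) →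
      ∀ (W' : WeierstrassCurve ℚ) [W'.IsElliptic] (P : ShimuraParametrizationData X W'),
        P.IsMinimalFor W →
          (∏ p ∈ D.primeFactors, (W.minimalDiscriminantNorm ℤ).factorization p) ≠ 0 ∧
          ((D₁.modularDegree : ℚ) /
              ((P.deg : ℚ) * (∏ p ∈ D.primeFactors, (W.minimalDiscriminantNorm ℤ).factorization p : ℕ))).den
            ∣ κ ^ D.primeFactors.card := by
  obtain ⟨κ, hκ1, hκ163, hκ⟩ := h
  refine ⟨κ, hκ1, hκ163, ?_⟩
  intro N D M _ hadm X W _ _ hN hclass W₁ _ D₁ hf hmin W' _ P hP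
  obtain ⟨a, b, ha, hb, hbκ, heq⟩ := hκ hadm X W hN hclass W₁ D₁ hf hmin W' P hP
  have hδ₁ : 0 < D₁.modularDegree := D₁.deg_pos
  have hPv := prod_ne_zero_of_clearedDenominators hδ₁ hb heq
  exact ⟨hPv, (den_div_dvd_of_clearedDenominators hb.ne' P.deg_pos.ne' hPv heq).trans hbκ⟩

/-- **Converse: the printed denominator statement gives back the fact.** If an absolute `κ ≥ 1`
supported on primes `≤ 163` is such that, under (b.1) or (b.2), `∏_{p∣D} v_p(Δ_E) ≠ 0` and the
denominator of `γ_{D,M,E} = δ_{1,N}/(δ_{D,M} ∏_{p∣D} v_p(Δ_E))` divides `κ^{ω(D)}`, then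
`PastenShimura2024_thm_6_1_b` holds, with `a = num(γ)`, `b = den(γ)` (`γ > 0`). So the tree's
cleared-denominator rendering is EQUIVALENT to the printed form (`…_iff_den_dvd`); the side
condition `∏ v_p(Δ_E) ≠ 0` is automatic in the source (`p ∣ D ∣ N_E` is a prime of bad, indeed
multiplicative, reduction, so `v_p(Δ_E) ≥ 1`). [cite: PastenShimura2024, Thm. 6.1 (b) p. 20 and display (6.1)] -/
theorem PastenShimura2024_thm_6_1_b_of_den_dvd
    (h : ∃ κ : ℕ, 1 ≤ κ ∧ (∀ p ∈ κ.primeFactors, p ≤ 163) ∧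
      ∀ {N D M : ℕ} [NeZero N], IsAdmissibleFactorization N D M →
        ∀ (X : ShimuraCurveData D M) (W : WeierstrassCurve ℚ) [W.IsElliptic] [W.IsGloballyMinimal],
          W.conductorNorm ℤ = N →
          (W.IsSemistable ℤ ∧ ¬ M.Prime) ∨
            (IsFreyHellegouarch W ∧ 2 ≤ (M.primeFactors.erase 2).card) →
        ∀ (W₁ : WeierstrassCurve ℚ) [W₁.IsElliptic] (D₁ : ModularParametrizationData W₁ N),
          IsNewformOf W D₁.f →
          (∀ (W₂ : WeierstrassCurve ℚ) [W₂.IsElliptic] (D₂ : ModularParametrizationData W₂ N),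
              D₂.f = D₁.f → D₁.modularDegree ≤ D₂.modularDegree) →
        ∀ (W' : WeierstrassCurve ℚ) [W'.IsElliptic] (P : ShimuraParametrizationData X W'),
          P.IsMinimalFor W →
            (∏ p ∈ D.primeFactors, (W.minimalDiscriminantNorm ℤ).factorization p) ≠ 0 ∧
            ((D₁.modularDegree : ℚ) /
                ((P.deg : ℚ) *
                  (∏ p ∈ D.primeFactors, (W.minimalDiscriminantNorm ℤ).factorization p : ℕ))).den
              ∣ κ ^ D.primeFactors.card) :
    PastenShimura2024_thm_6_1_b := by
  obtain ⟨κ, hκ1, hκ163, hκ⟩ := h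
  refine ⟨κ, hκ1, hκ163, ?_⟩
  intro N D M _ hadm X W _ _ hN hclass W₁ _ D₁ hf hmin W' _ P hP
  obtain ⟨hPv, hden⟩ := hκ hadm X W hN hclass W₁ D₁ hf hmin W' P hP
  -- the positive rational number `γ = δ₁ / (δ · Π)`
  set Pv : ℕ := ∏ p ∈ D.primeFactors, (W.minimalDiscriminantNorm ℤ).factorization p with hPv_def
  set γ : ℚ := (D₁.modularDegree : ℚ) / ((P.deg : ℚ) * (Pv : ℚ)) with hγ_def
  have hδ₁ : (0 : ℚ) < D₁.modularDegree := by exact_mod_cast D₁.deg_pos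
  have hδ : (0 : ℚ) < P.deg := by exact_mod_cast P.deg_pos
  have hPv' : (0 : ℚ) < Pv := by exact_mod_cast Nat.pos_of_ne_zero hPv
  have hγpos : 0 < γ := div_pos hδ₁ (mul_pos hδ hPv')
  have hnum_pos : 0 < γ.num := Rat.num_pos.2 hγpos
  refine ⟨γ.num.toNat, γ.den, by omega, γ.den_pos, hden, ?_⟩
  -- `δ₁ · den γ = num γ · δ · Π`, from `γ = num γ / den γ`
  have hnum : ((γ.num.toNat : ℕ) : ℚ) = γ.num := by
    exact_mod_cast Int.toNat_of_nonneg hnum_pos.le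
  have key : (D₁.modularDegree : ℚ) * γ.den = γ.num * ((P.deg : ℚ) * Pv) := by
    have h1 : (D₁.modularDegree : ℚ) / ((P.deg : ℚ) * Pv) = γ.num / γ.den := by
      rw [Rat.num_div_den γ]
    rwa [div_eq_div_iff (mul_pos hδ hPv').ne' (by exact_mod_cast γ.den_pos.ne')] at h1
  have hcast : ((D₁.modularDegree * γ.den : ℕ) : ℚ) = ((γ.num.toNat * P.deg * Pv : ℕ) : ℚ) := by
    push_cast
    rw [hnum, key]
    ring
  exact_mod_cast hcast

/-- **The tree's rendering of Thm. 6.1 (b) is equivalent to the printed denominator statement**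
(`den(γ_{D,M,E}) ∣ κ^{ω(D)}` together with `∏_{p∣D} v_p(Δ_E) ≠ 0`, same absolute `κ`).
[cite: PastenShimura2024, Thm. 6.1 (b) p. 20 and display (6.1)] -/
theorem PastenShimura2024_thm_6_1_b_iff_den_dvd :
    PastenShimura2024_thm_6_1_b ↔
    ∃ κ : ℕ, 1 ≤ κ ∧ (∀ p ∈ κ.primeFactors, p ≤ 163) ∧
      ∀ {N D M : ℕ} [NeZero N], IsAdmissibleFactorization N D M →
        ∀ (X : ShimuraCurveData D M) (W : WeierstrassCurve ℚ) [W.IsElliptic] [W.IsGloballyMinimal],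
          W.conductorNorm ℤ = N →
          (W.IsSemistable ℤ ∧ ¬ M.Prime) ∨
            (IsFreyHellegouarch W ∧ 2 ≤ (M.primeFactors.erase 2).card) →
        ∀ (W₁ : WeierstrassCurve ℚ) [W₁.IsElliptic] (D₁ : ModularParametrizationData W₁ N),
          IsNewformOf W D₁.f →
          (∀ (W₂ : WeierstrassCurve ℚ) [W₂.IsElliptic] (D₂ : ModularParametrizationData W₂ N),
              D₂.f = D₁.f → D₁.modularDegree ≤ D₂.modularDegree) →
        ∀ (W' : WeierstrassCurve ℚ) [W'.IsElliptic] (P : ShimuraParametrizationData X W'),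
          P.IsMinimalFor W →
            (∏ p ∈ D.primeFactors, (W.minimalDiscriminantNorm ℤ).factorization p) ≠ 0 ∧
            ((D₁.modularDegree : ℚ) /
                ((P.deg : ℚ) *
                  (∏ p ∈ D.primeFactors, (W.minimalDiscriminantNorm ℤ).factorization p : ℕ))).den
              ∣ κ ^ D.primeFactors.card :=
  ⟨PastenShimura2024_thm_6_1_b.den_dvd, PastenShimura2024_thm_6_1_b_of_den_dvd⟩

/-- **Pasten 2024, Thm. 6.1 (b), "In particular": `log(∏_{p∣D} v_p(Δ_E)) ≤ log δ_{1,N} − log δ_{D,M}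
+ O(ω(D))` with an absolute implicit constant** — PROVED from the named fact
`PastenShimura2024_thm_6_1_b`, with the explicit absolute constant `C = log κ ≥ 0`: under (b.1) or
(b.2), `log(∏_{p∣D} v_p(Δ_E)) ≤ log δ_{1,N} − log δ_{D,M} + C · ω(D)` (from
`δ_{1,N} b = a δ_{D,M} Pv`, `a ≥ 1`, `b ≤ κ^{ω(D)}`). Rendering of `δ_{1,N}`, `δ_{D,M}`, `v_p(Δ_E)` as
in the fact. [cite: PastenShimura2024, Thm. 6.1 (b) p. 20 ("In particular")] -/
theorem PastenShimura2024_thm_6_1_b.log_prod_le (h : PastenShimura2024_thm_6_1_b) :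
    ∃ C : ℝ, 0 ≤ C ∧
    ∀ {N D M : ℕ} [NeZero N], IsAdmissibleFactorization N D M →
      ∀ (X : ShimuraCurveData D M) (W : WeierstrassCurve ℚ) [W.IsElliptic] [W.IsGloballyMinimal],
        W.conductorNorm ℤ = N →
        (W.IsSemistable ℤ ∧ ¬ M.Prime) ∨
          (IsFreyHellegouarch W ∧ 2 ≤ (M.primeFactors.erase 2).card) →
      ∀ (W₁ : WeierstrassCurve ℚ) [W₁.IsElliptic] (D₁ : ModularParametrizationData W₁ N),
        IsNewformOf W D₁.f →
        (∀ (W₂ : WeierstrassCurve ℚ) [W₂.IsElliptic] (D₂ : ModularParametrizationData W₂ N),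
            D₂.f = D₁.f → D₁.modularDegree ≤ D₂.modularDegree) →
      ∀ (W' : WeierstrassCurve ℚ) [W'.IsElliptic] (P : ShimuraParametrizationData X W'),
        P.IsMinimalFor W →
          Real.log ((∏ p ∈ D.primeFactors, (W.minimalDiscriminantNorm ℤ).factorization p : ℕ) : ℝ)
            ≤ Real.log (D₁.modularDegree : ℝ) - Real.log (P.deg : ℝ)
              + C * (D.primeFactors.card : ℝ) := by
  obtain ⟨κ, hκ1, -, hκ⟩ := h
  refine ⟨Real.log κ, Real.log_nonneg (by exact_mod_cast hκ1), ?_⟩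
  intro N D M _ hadm X W _ _ hN hclass W₁ _ D₁ hf hmin W' _ P hP
  obtain ⟨a, b, ha, hb, hbκ, heq⟩ := hκ hadm X W hN hclass W₁ D₁ hf hmin W' P hP
  have hκpos : 0 < κ ^ D.primeFactors.card := pow_pos hκ1 _
  have hbK : b ≤ κ ^ D.primeFactors.card := Nat.le_of_dvd hκpos hbκ
  have hδ₁ : 0 < D₁.modularDegree := D₁.deg_pos
  have hmain := log_prod_le_of_clearedDenominators hδ₁ ha hb P.deg_pos hbK heq
  have hlogK : Real.log ((κ ^ D.primeFactors.card : ℕ) : ℝ) = Real.log κ * D.primeFactors.card := by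
    rw [Nat.cast_pow, Real.log_pow]; ring
  rw [hlogK] at hmain
  exact hmain

/-! ### Theorem 6.1 (numerator): the printed logarithmic form (EqUpperRT) -/

/-- **Pasten 2024, Thm. 6.1, "In particular" (EqUpperRT):
`log δ_{1,N} ≤ log δ_{D,M} + log(∏_{p∣D} v_p(Δ_E)) + 5.1 · ω(D)`** — PROVED from the named fact
`PastenShimura2024_thm_6_1` (numerator of `γ_{D,M,E}` at most `163^{ω(D)}`): from
`δ_{1,N} b = a δ_{D,M} Pv` with `b ≥ 1`, `a ≤ 163^{ω(D)}`, and `log 163 ≤ 5.1` (`log_163_le`).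
Valid for every admissible `N = DM`, no hypothesis on `E`, exactly as printed. Rendering of
`δ_{1,N}`, `δ_{D,M}`, `v_p(Δ_E)` as in the fact. [cite: PastenShimura2024, Thm. 6.1 p. 20 ((EqUpperRT))] -/
theorem PastenShimura2024_thm_6_1.log_le (h : PastenShimura2024_thm_6_1) :
    ∀ {N D M : ℕ} [NeZero N], IsAdmissibleFactorization N D M →
      ∀ (X : ShimuraCurveData D M) (W : WeierstrassCurve ℚ) [W.IsElliptic] [W.IsGloballyMinimal],
        W.conductorNorm ℤ = N →
      ∀ (W₁ : WeierstrassCurve ℚ) [W₁.IsElliptic] (D₁ : ModularParametrizationData W₁ N),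
        IsNewformOf W D₁.f →
        (∀ (W₂ : WeierstrassCurve ℚ) [W₂.IsElliptic] (D₂ : ModularParametrizationData W₂ N),
            D₂.f = D₁.f → D₁.modularDegree ≤ D₂.modularDegree) →
      ∀ (W' : WeierstrassCurve ℚ) [W'.IsElliptic] (P : ShimuraParametrizationData X W'),
        P.IsMinimalFor W →
          Real.log (D₁.modularDegree : ℝ) ≤ Real.log (P.deg : ℝ)
            + Real.log ((∏ p ∈ D.primeFactors, (W.minimalDiscriminantNorm ℤ).factorization p : ℕ) : ℝ)
            + 5.1 * (D.primeFactors.card : ℝ) := by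
  intro N D M _ hadm X W _ _ hN W₁ _ D₁ hf hmin W' _ P hP
  obtain ⟨a, b, ha, hb, ha163, -, heq⟩ := h hadm X W hN W₁ D₁ hf hmin W' P hP
  have hδ₁ : 0 < D₁.modularDegree := D₁.deg_pos
  have hmain := log_le_of_clearedDenominators hδ₁ ha hb P.deg_pos ha163 heq
  have hlogA : Real.log ((163 ^ D.primeFactors.card : ℕ) : ℝ)
      = Real.log 163 * D.primeFactors.card := by
    rw [Nat.cast_pow, Real.log_pow]; push_cast; ring
  rw [hlogA] at hmain
  have hω : (0 : ℝ) ≤ D.primeFactors.card := Nat.cast_nonneg _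
  have h163 : Real.log 163 * D.primeFactors.card ≤ 5.1 * D.primeFactors.card :=
    mul_le_mul_of_nonneg_right log_163_le hω
  linarith

end Literature.NumberTheory.Automorphic

end
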